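import Summits.QuantumFields.BalabanUV.Beta.EriceFlowEnclosureB12AsPrintedPointwiseFadingOrder

/-!
# Beta / EriceFlowEnclosureB12AsPrintedPointwiseFadingOrderSharpOscillation — WHAT (0.31) FORCES POINTWISE, part 7♯, THE EDGE OF THE COMPARISON METHODS.
# Same-length uniqueness ∕ order of two runs of (0.20) under node U2's coupling-chart moduli `HistLipschitz Λ γ β` + `FadingMemory C θ Λ` is proved in the
# tree by TWO linear comparison arguments on the discrepancy Δ_j = 1∕g_j² − 1∕g′_j², both fed by |β_{k+1}(g_{≤k}) − β_{k+1}(g′_{≤k})| ≤ (Cγ³∕2) Σ_{i≤k} θ^{k−i}|Δ_i|: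
# node U2's BACKWARD weighted maximum (`T4TwoRunUniqueness.weighted_zero` ∕ `eq_of_pin_fadingMemory_rho`: a ratio ρ′ > 1 with (Cγ³∕2)ρ′ < (1 − ρ′θ)(ρ′ − 1))
# and this lineage's FORWARD ratio chain (`…PointwiseFadingOrderSharp.sep_geometric_ratio`: a ratio ρ > θ with (Cγ³∕2)·ρ∕(ρ − θ) ≤ 1 − ρ).  This module
# records, as pure real algebra, WHERE BOTH STOP and WHY:
# (§1) the admissible constants are the SAME function c(ρ) = (1 − ρ)(ρ − θ)∕ρ = 1 + θ − ρ − θ∕ρ (forward, ρ) = (1 − ρ′θ)(ρ′ − 1)∕ρ′ (backward, ρ′ = 1∕ρ), bounded by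
# **(1 − √θ)²** with equality exactly at ρ = √θ (`admissible_forward_le ∕ _sqrt`, `admissible_backward_le ∕ _sqrt`): no choice of ratio in either method
# reaches a box with Cγ³ > 2(1 − √θ)² (`no_forward_ratio_above`, `no_backward_ratio_above`);
# (§2) the reason is not the methods but the recursion: the ADVERSARIAL comparison sequence — the fading feedback taken with the killing sign at full
# strength, D_{k+1} = D_k − Σ_{i≤k} θ^{k−i} c_i D_i with coefficients c_i ≥ c₋ — obeys the two-term recursion D_{k+2} = (1 + θ − c_{k+1})D_{k+1} − θD_k
# (`twoTerm_of_sumForm`), whose characteristic polynomial λ² − (1 + θ − c)λ + θ has the double root √θ at c = (1 − √θ)² and COMPLEX roots beyond: for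
# p := 1 + θ − c₋ < 2√θ NO solution with D_0 > 0 stays positive — **`oscillation_pos`** (0 < p: some D_j ≤ 0 with j ≤ n + 1 as soon as n ≥ p²∕(θ − p²∕4) + 1,
# by the ratio decrement D_{m+2} ≤ (p − m·μ∕p)D_{m+1}, μ = θ − p²∕4) and `oscillation_nonpos` (p ≤ 0: j ≤ 2); in particular every solution of the
# constant-coefficient model with c > (1 − √θ)² changes sign (**`model_signChange`**), while for c ≤ (1 − √θ)² the forward chain keeps it positive
# (`…Sharp.sep_geometric_ratio`).  So 2(1 − √θ)² is the exact edge of ANY argument that uses the moduli only through the absolute feedback bound — the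
# number prover 1 conjectured for the sharp threshold t(θ) of reference-free uniqueness (bflow-p1 gen 35 NEXT (A), «≍ 2(1−√θ)²»); whether a family INSIDE
# the moduli realises the adversarial signs along two actual runs (order reversal above the edge) is the companion `…SharpWitness`'s business
# (β-flow team, prover 2 = lower ∕ positivity side, unit `b2b-balaban-beta-bflow-p2`, gen 45; ROW AP-I × node U2's letters)

HONEST FRAMING (page 1 of everything the β sub-cell writes): discharging `BetaPertH` makes Bałaban's UV stability UNCONDITIONAL — a
real constructive-QFT result; it is NOT the continuum limit and NOT the Clay problem.  HONEST DEPENDENCY (cell reorg 2026-08-19,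
verbatim): «continuum YM on T⁴ ⇐ BetaPertH ∧ nine spine estimates (0/9 proved); BetaPertH ⇐ (D1) ∧ (D4) ∧ CAP+tail; G-an2-4 gates
asym, D1 and NE2/3/4.»  THIS MODULE DISCHARGES NOTHING: it is [folklore] algebra of one real function and of real sequences obeying a linear
two-term recursion; its only link to [I] = T. Bałaban, Commun. Math. Phys. **109** (1987) [Balaban1987RG1] is that the recursion is the one the
difference of (0.20) p. 256 for two runs obeys under node U2's UNPRINTED hypothesis shapes (GAPS G-t4-U2-2) when every modulus inequality is an
equality with the adverse sign.  Nothing about Bałaban's β is asserted.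

WHAT THIS FILE PROVES (0 sorry, 0 def): §1 `admissible_forward_le`, `admissible_forward_sqrt`, `admissible_backward_le`, `admissible_backward_sqrt`,
`no_forward_ratio_above`, `no_backward_ratio_above`; §2 `twoTerm_of_sumForm`, **`oscillation_pos`**, `oscillation_nonpos`, **`model_signChange`**;
§3 (v1.1, finite horizon — the recursion assumed only up to the depth used) `twoTerm_at`, `oscillation_pos_fin`, `oscillation_nonpos_fin`, **`oscillation_fin`**.
NOT CLAIMED: that a family inside the moduli attains the adversarial recursion (companion); anything about Bałaban's β; Theorem 2; `BetaPertH`; continuum; Clay.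
-/

namespace Summit.QuantumFields.BalabanUV.Beta.EriceFlowEnclosureB12AsPrintedPointwiseFadingOrderSharpOscillation

open Finset

noncomputable section

/-! ## §1 The admissible constant of both comparison methods is at most (1 − √θ)², attained at ratio √θ -/

/-- **FORWARD METHOD**: for θ ≥ 0 and a ratio ρ > 0, the admissible constant `(1 − ρ)(ρ − θ)∕ρ` of `…Sharp.sep_geometric_ratio` is ≤ (1 − √θ)² — since
(1 − √θ)²ρ − (1 − ρ)(ρ − θ) = (ρ − √θ)². [folklore] -/
theorem admissible_forward_le {θ ρ : ℝ} (hθ : 0 ≤ θ) (hρ : 0 < ρ) :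
    (1 - ρ) * (ρ - θ) / ρ ≤ (1 - Real.sqrt θ) ^ 2 := by
  have hsq : Real.sqrt θ ^ 2 = θ := Real.sq_sqrt hθ
  rw [div_le_iff₀ hρ]
  nlinarith [sq_nonneg (ρ - Real.sqrt θ), hsq]

/-- **FORWARD METHOD, EQUALITY AT ρ = √θ** (θ > 0): `(1 − √θ)(√θ − θ)∕√θ = (1 − √θ)²`. [folklore] -/
theorem admissible_forward_sqrt {θ : ℝ} (hθ : 0 < θ) :
    (1 - Real.sqrt θ) * (Real.sqrt θ - θ) / Real.sqrt θ = (1 - Real.sqrt θ) ^ 2 := by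
  have hs0 : 0 < Real.sqrt θ := Real.sqrt_pos.mpr hθ
  have hsq : Real.sqrt θ * Real.sqrt θ = θ := Real.mul_self_sqrt hθ.le
  rw [div_eq_iff hs0.ne']
  linear_combination (1 - Real.sqrt θ) * hsq

/-- **BACKWARD METHOD** (node U2's `T4TwoRunUniqueness.weighted_zero`): for θ ≥ 0 and a ratio ρ′ > 0, the admissible constant `(1 − ρ′θ)(ρ′ − 1)∕ρ′` is
≤ (1 − √θ)² — since (1 − √θ)²ρ′ − (1 − ρ′θ)(ρ′ − 1) = (1 − √θ·ρ′)².  (It is the forward function at ρ = 1∕ρ′.) [folklore] -/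
theorem admissible_backward_le {θ ρ' : ℝ} (hθ : 0 ≤ θ) (hρ : 0 < ρ') :
    (1 - ρ' * θ) * (ρ' - 1) / ρ' ≤ (1 - Real.sqrt θ) ^ 2 := by
  have hsq : Real.sqrt θ ^ 2 = θ := Real.sq_sqrt hθ
  have key : (1 - Real.sqrt θ) ^ 2 * ρ' - (1 - ρ' * θ) * (ρ' - 1) = (1 - Real.sqrt θ * ρ') ^ 2 := by
    linear_combination (ρ' - ρ' ^ 2) * hsq
  rw [div_le_iff₀ hρ]
  nlinarith [key, sq_nonneg (1 - Real.sqrt θ * ρ')]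

/-- **BACKWARD METHOD, EQUALITY AT ρ′ = 1∕√θ** (θ > 0): `(1 − θ∕√θ)(1∕√θ − 1)·√θ = (1 − √θ)²` — node U2's `eq_of_pin_fadingMemory_rho` read at ρ′ = 1∕√θ is the
box Cγ³ < 2(1 − √θ)² (`…Sharp.runs_eq_of_fadingMemory_sqrt_U2`). [folklore] -/
theorem admissible_backward_sqrt {θ : ℝ} (hθ : 0 < θ) :
    (1 - 1 / Real.sqrt θ * θ) * (1 / Real.sqrt θ - 1) / (1 / Real.sqrt θ) = (1 - Real.sqrt θ) ^ 2 := by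
  have hs0 : 0 < Real.sqrt θ := Real.sqrt_pos.mpr hθ
  have hsq : Real.sqrt θ * Real.sqrt θ = θ := Real.mul_self_sqrt hθ.le
  have e0 : 1 / Real.sqrt θ * θ = Real.sqrt θ := by
    rw [div_mul_eq_mul_div, one_mul, div_eq_iff hs0.ne']; exact hsq.symm
  rw [e0, div_eq_iff (one_div_pos.mpr hs0).ne']
  have hinv : Real.sqrt θ * (1 / Real.sqrt θ) = 1 := by field_simp
  linear_combination (1 - Real.sqrt θ) * hinv

/-- **NO FORWARD RATIO ABOVE THE EDGE**: if c > (1 − √θ)² (θ ≥ 0) then no ratio ρ > θ satisfies the closing condition `c·ρ∕(ρ − θ) ≤ 1 − ρ` of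
`…Sharp.sep_geometric_ratio`. [folklore] -/
theorem no_forward_ratio_above {θ c ρ : ℝ} (hθ : 0 ≤ θ) (hc : (1 - Real.sqrt θ) ^ 2 < c) (hρ : θ < ρ)
    (h : c * (ρ / (ρ - θ)) ≤ 1 - ρ) : False := by
  have hρ0 : 0 < ρ := lt_of_le_of_lt hθ hρ
  have hρθ : 0 < ρ - θ := sub_pos.mpr hρ
  rw [← mul_div_assoc, div_le_iff₀ hρθ] at h
  have h2 : c ≤ (1 - ρ) * (ρ - θ) / ρ := by rw [le_div_iff₀ hρ0]; linarith
  linarith [admissible_forward_le hθ hρ0]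

/-- **NO BACKWARD RATIO ABOVE THE EDGE**: if a ≥ (1 − √θ)² (θ ≥ 0) then no ratio ρ′ > 0 satisfies node U2's smallness `a·ρ′ < (1 − ρ′θ)(ρ′ − 1)` of
`T4TwoRunUniqueness.weighted_zero` ∕ `eq_of_pin_fadingMemory_rho`. [folklore] -/
theorem no_backward_ratio_above {θ a ρ' : ℝ} (hθ : 0 ≤ θ) (ha : (1 - Real.sqrt θ) ^ 2 ≤ a) (hρ : 0 < ρ')
    (h : a * ρ' < (1 - ρ' * θ) * (ρ' - 1)) : False := by
  have h2 : a < (1 - ρ' * θ) * (ρ' - 1) / ρ' := by rw [lt_div_iff₀ hρ]; linarith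
  linarith [admissible_backward_le hθ hρ]

/-! ## §2 The adversarial comparison recursion oscillates above the edge -/

/-- **SUM FORM ⟹ TWO-TERM FORM.**  If `D_{k+1} = D_k − Σ_{i≤k} θ^{k−i}·c_i·D_i` for every k (the fading feedback at full adverse strength, coefficient c_i
attached to the AGE-i coordinate), then `D_{k+2} = (1 + θ − c_{k+1})·D_{k+1} − θ·D_k`: the memory sum S_k obeys S_{k+1} = θS_k + c_{k+1}D_{k+1} and S_k = D_k − D_{k+1}.
Characteristic polynomial λ² − (1 + θ − c)λ + θ: real roots iff |1 + θ − c| ≥ 2√θ, double root √θ at c = (1 − √θ)². [folklore] -/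
theorem twoTerm_of_sumForm {θ : ℝ} {c D : ℕ → ℝ}
    (hrec : ∀ k, D (k + 1) = D k - ∑ i ∈ range (k + 1), θ ^ (k - i) * c i * D i) (k : ℕ) :
    D (k + 2) = (1 + θ - c (k + 1)) * D (k + 1) - θ * D k := by
  have h1 := hrec (k + 1)
  have h0 := hrec k
  rw [Finset.sum_range_succ] at h1
  have hs : ∑ i ∈ range (k + 1), θ ^ (k + 1 - i) * c i * D i
      = θ * ∑ i ∈ range (k + 1), θ ^ (k - i) * c i * D i := by
    rw [Finset.mul_sum]
    refine Finset.sum_congr rfl fun i hi => ?_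
    have hik : i ≤ k := Nat.lt_succ_iff.mp (mem_range.mp hi)
    rw [show k + 1 - i = (k - i) + 1 by omega, pow_succ]
    ring
  rw [hs, Nat.sub_self, pow_zero, one_mul] at h1
  have hS : ∑ i ∈ range (k + 1), θ ^ (k - i) * c i * D i = D k - D (k + 1) := by linarith
  rw [hS] at h1
  have e : D (k + 2) = D (k + 1 + 1) := rfl
  rw [e, h1]
  ring

/-- **THE RATIO DECREMENT — NO POSITIVE SOLUTION ABOVE THE EDGE (0 < p < 2√θ).**  Let θ > 0 and 0 < p with p² < 4θ, and let D satisfy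
`D_{k+2} ≤ p·D_{k+1} − θ·D_k` whenever `D_{k+1} ≥ 0` (the two-term form with coefficients c_{k+1} ≥ c₋, p = 1 + θ − c₋, along a nonnegative stretch).  If D_0 > 0
then D_j ≤ 0 for some j ≤ n + 1 as soon as `n ≥ p²∕(θ − p²∕4) + 1`.  (While D stays positive, D_{m+2} ≤ (p − m·μ∕p)·D_{m+1} with μ := θ − p²∕4 > 0: from
D_{m+2} ≤ s·D_{m+1}, s > 0, the recursion gives D_{m+3} ≤ (p − θ∕s)D_{m+2} and p − θ∕s ≤ s − μ∕p because s² − ps + θ ≥ μ ≥ (μ∕p)s; the factor is ≤ 0 after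
p²∕μ steps.)  Uniform in the coefficients: only c_{k+1} ≥ c₋ enters. [folklore] -/
theorem oscillation_pos {θ p : ℝ} {D : ℕ → ℝ} (hθ : 0 < θ) (hp0 : 0 < p) (hp : p ^ 2 < 4 * θ)
    (hrec : ∀ k, 0 ≤ D (k + 1) → D (k + 2) ≤ p * D (k + 1) - θ * D k)
    (hD0 : 0 < D 0) {n : ℕ} (hn : p ^ 2 / (θ - p ^ 2 / 4) + 1 ≤ n) :
    ∃ j, j ≤ n + 1 ∧ D j ≤ 0 := by
  by_contra hneg
  have hcon : ∀ j, j ≤ n + 1 → 0 < D j := fun j hj => lt_of_not_ge fun h => hneg ⟨j, hj, h⟩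
  set μ : ℝ := θ - p ^ 2 / 4 with hμ
  have hμpos : 0 < μ := by rw [hμ]; linarith
  set d : ℝ := μ / p with hd
  have hdpos : 0 < d := div_pos hμpos hp0
  have hdp : d * p = μ := by rw [hd]; field_simp
  have hn1 : 1 ≤ n := by
    have h1 : (1 : ℝ) ≤ n := le_trans (by linarith [div_nonneg (sq_nonneg p) hμpos.le]) hn
    exact_mod_cast h1
  -- invariant: for m + 1 ≤ n, D (m+2) ≤ (p − m d) · D (m+1)
  have inv : ∀ m : ℕ, m + 1 ≤ n → D (m + 2) ≤ (p - m * d) * D (m + 1) := by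
    intro m
    induction m with
    | zero =>
      intro _
      have h := hrec 0 (hcon 1 (by omega)).le
      simp only [Nat.cast_zero, zero_mul, sub_zero]
      nlinarith [hD0, h]
    | succ m ih =>
      intro hm
      have hprev := ih (by omega)
      have hpos1 : 0 < D (m + 1) := hcon (m + 1) (by omega)
      have hpos2 : 0 < D (m + 2) := hcon (m + 2) (by omega)
      set s : ℝ := p - m * d with hs
      have hspos : 0 < s := by
        rcases le_or_gt s 0 with hsn | hsp
        · have : D (m + 2) ≤ 0 := hprev.trans (mul_nonpos_of_nonpos_of_nonneg hsn hpos1.le)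
          linarith
        · exact hsp
      have hsle : s ≤ p := by
        rw [hs]; nlinarith [hdpos, (Nat.cast_nonneg m : (0 : ℝ) ≤ m)]
      -- D (m+1) ≥ D (m+2) / s
      have hlow : D (m + 2) / s ≤ D (m + 1) := by rw [div_le_iff₀ hspos]; linarith [hprev, mul_comm s (D (m + 1))]
      have hr := hrec (m + 1) hpos2.le
      -- D (m+3) ≤ p D(m+2) − θ D(m+1) ≤ p D(m+2) − θ D(m+2)/s = (p − θ/s) D(m+2)
      have h3 : D (m + 1 + 2) ≤ (p - θ / s) * D (m + 2) := by
        have hθs : θ * (D (m + 2) / s) ≤ θ * D (m + 1) := mul_le_mul_of_nonneg_left hlow hθ.le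
        have e : (p - θ / s) * D (m + 2) = p * D (m + 2) - θ * (D (m + 2) / s) := by ring
        rw [e]
        have e2 : D (m + 1 + 1) = D (m + 2) := rfl
        rw [e2] at hr
        linarith
      -- p − θ/s ≤ s − d
      have hquad : μ ≤ s ^ 2 - p * s + θ := by
        rw [hμ]; nlinarith [sq_nonneg (s - p / 2)]
      have hcoef : p - θ / s ≤ s - d := by
        rw [sub_le_iff_le_add, ← sub_le_iff_le_add', le_div_iff₀ hspos] at *
        · nlinarith [hquad, hsle, hdpos, hdp]
      have e3 : (m + 1 + 2 : ℕ) = m + 1 + 2 := rfl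
      calc D (m + 1 + 2) ≤ (p - θ / s) * D (m + 2) := h3
        _ ≤ (s - d) * D (m + 2) := mul_le_mul_of_nonneg_right hcoef hpos2.le
        _ = (p - ((m + 1 : ℕ) : ℝ) * d) * D (m + 1 + 1) := by rw [hs]; push_cast; ring
  -- at m = n − 1 the factor is ≤ 0
  obtain ⟨m, rfl⟩ : ∃ m, n = m + 1 := ⟨n - 1, by omega⟩
  have hlast := inv m le_rfl
  have hfac : p - (m : ℝ) * d ≤ 0 := by
    have hm : p ^ 2 / μ ≤ (m : ℝ) := by
      have : ((m + 1 : ℕ) : ℝ) = (m : ℝ) + 1 := by push_cast; ring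
      rw [this] at hn; linarith
    have : p ^ 2 ≤ (m : ℝ) * μ := by rwa [div_le_iff₀ hμpos] at hm
    nlinarith [hdp, this, hp0]
  have hDm1 : 0 < D (m + 1) := hcon (m + 1) (by omega)
  have hDm2 : 0 < D (m + 2) := hcon (m + 2) (by omega)
  have : D (m + 2) ≤ 0 := hlast.trans (mul_nonpos_of_nonpos_of_nonneg hfac hDm1.le)
  linarith

/-- **NO POSITIVE SOLUTION WHEN p ≤ 0** (c₋ ≥ 1 + θ): D_0 > 0 ⟹ D_1 ≤ 0 or D_2 ≤ p·D_1 − θ·D_0 < 0. [folklore] -/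
theorem oscillation_nonpos {θ p : ℝ} {D : ℕ → ℝ} (hθ : 0 < θ) (hp : p ≤ 0)
    (hrec : ∀ k, 0 ≤ D (k + 1) → D (k + 2) ≤ p * D (k + 1) - θ * D k) (hD0 : 0 < D 0) :
    ∃ j, j ≤ 2 ∧ D j ≤ 0 := by
  rcases le_or_gt (D 1) 0 with h1 | h1
  · exact ⟨1, by norm_num, h1⟩
  · refine ⟨2, le_rfl, ?_⟩
    have h := hrec 0 h1.le
    nlinarith [mul_nonpos_of_nonpos_of_nonneg hp h1.le, mul_pos hθ hD0]

/-- **THE CONSTANT-COEFFICIENT MODEL CHANGES SIGN ABOVE THE EDGE.**  For 0 < θ and c > (1 − √θ)²: every real sequence with D_0 > 0 and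
`D_{k+1} = D_k − c·Σ_{i≤k} θ^{k−i} D_i` (the discrepancy recursion of two runs of (0.20) with the fading feedback Cγ³∕2 = c taken at full adverse strength at
every age) has a term D_j ≤ 0 — whereas for c ≤ (1 − √θ)² the forward chain of `…Sharp.sep_geometric_ratio` (ratio √θ) keeps every such sequence positive.
(1 + θ − c < 2√θ; `twoTerm_of_sumForm` + `oscillation_pos` ∕ `oscillation_nonpos`.) [cite: Balaban1987RG1, (0.20) p.256 with p.298] -/
theorem model_signChange {θ c : ℝ} {D : ℕ → ℝ} (hθ : 0 < θ) (hc : (1 - Real.sqrt θ) ^ 2 < c)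
    (hrec : ∀ k, D (k + 1) = D k - c * ∑ i ∈ range (k + 1), θ ^ (k - i) * D i) (hD0 : 0 < D 0) :
    ∃ j, D j ≤ 0 := by
  have hs0 : 0 < Real.sqrt θ := Real.sqrt_pos.mpr hθ
  have hsq : Real.sqrt θ ^ 2 = θ := Real.sq_sqrt hθ.le
  -- two-term form with constant coefficient
  have hrec' : ∀ k, D (k + 1) = D k - ∑ i ∈ range (k + 1), θ ^ (k - i) * (fun _ => c) i * D i := by
    intro k; rw [hrec k, Finset.mul_sum]
    refine congrArg _ (Finset.sum_congr rfl fun i _ => by ring)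
  have htwo : ∀ k, 0 ≤ D (k + 1) → D (k + 2) ≤ (1 + θ - c) * D (k + 1) - θ * D k :=
    fun k _ => (twoTerm_of_sumForm hrec' k).le
  set p : ℝ := 1 + θ - c with hp
  have hp2 : p < 2 * Real.sqrt θ := by rw [hp]; nlinarith [hc, hsq]
  rcases le_or_gt p 0 with hp0 | hp0
  · obtain ⟨j, -, hj⟩ := oscillation_nonpos hθ hp0 htwo hD0
    exact ⟨j, hj⟩
  · have hp4 : p ^ 2 < 4 * θ := by nlinarith [hp2, hp0, hs0, hsq]
    obtain ⟨n, hn⟩ := exists_nat_ge (p ^ 2 / (θ - p ^ 2 / 4) + 1)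
    obtain ⟨j, -, hj⟩ := oscillation_pos hθ hp0 hp4 htwo hD0 hn
    exact ⟨j, hj⟩

/-! ## §3 Finite-horizon forms (v1.1): the recursion is only needed up to the depth where the sign change is produced -/

/-- **SUM FORM ⟹ TWO-TERM FORM, ONE SCALE AT A TIME.**  The two consecutive sum-form identities at k and k + 1 alone give
`D_{k+2} = (1 + θ − c_{k+1})·D_{k+1} − θ·D_k` (pointwise version of `twoTerm_of_sumForm`, for recursions valid only up to a horizon). [folklore] -/
theorem twoTerm_at {θ : ℝ} {c D : ℕ → ℝ} (k : ℕ)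
    (h0 : D (k + 1) = D k - ∑ i ∈ range (k + 1), θ ^ (k - i) * c i * D i)
    (h1 : D (k + 1 + 1) = D (k + 1) - ∑ i ∈ range (k + 1 + 1), θ ^ (k + 1 - i) * c i * D i) :
    D (k + 2) = (1 + θ - c (k + 1)) * D (k + 1) - θ * D k := by
  rw [Finset.sum_range_succ] at h1
  have hs : ∑ i ∈ range (k + 1), θ ^ (k + 1 - i) * c i * D i
      = θ * ∑ i ∈ range (k + 1), θ ^ (k - i) * c i * D i := by
    rw [Finset.mul_sum]
    refine Finset.sum_congr rfl fun i hi => ?_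
    have hik : i ≤ k := Nat.lt_succ_iff.mp (mem_range.mp hi)
    rw [show k + 1 - i = (k - i) + 1 by omega, pow_succ]
    ring
  rw [hs, Nat.sub_self, pow_zero, one_mul] at h1
  have hS : ∑ i ∈ range (k + 1), θ ^ (k - i) * c i * D i = D k - D (k + 1) := by linarith
  rw [hS] at h1
  have e : D (k + 2) = D (k + 1 + 1) := rfl
  rw [e, h1]
  ring

/-- **THE RATIO DECREMENT ON A FINITE HORIZON.**  `oscillation_pos` with the two-term inequality assumed only for k + 1 ≤ n (the scales its proof uses):
θ > 0, 0 < p, p² < 4θ, `D_{k+2} ≤ p·D_{k+1} − θ·D_k` whenever k + 1 ≤ n and D_{k+1} ≥ 0, D_0 > 0, n ≥ p²∕(θ − p²∕4) + 1 ⟹ D_j ≤ 0 for some j ≤ n + 1. [folklore] -/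
theorem oscillation_pos_fin {θ p : ℝ} {D : ℕ → ℝ} (hθ : 0 < θ) (hp0 : 0 < p) (hp : p ^ 2 < 4 * θ) {n : ℕ}
    (hrec : ∀ k, k + 1 ≤ n → 0 ≤ D (k + 1) → D (k + 2) ≤ p * D (k + 1) - θ * D k)
    (hD0 : 0 < D 0) (hn : p ^ 2 / (θ - p ^ 2 / 4) + 1 ≤ n) :
    ∃ j, j ≤ n + 1 ∧ D j ≤ 0 := by
  by_contra hneg
  have hcon : ∀ j, j ≤ n + 1 → 0 < D j := fun j hj => lt_of_not_ge fun h => hneg ⟨j, hj, h⟩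
  set μ : ℝ := θ - p ^ 2 / 4 with hμ
  have hμpos : 0 < μ := by rw [hμ]; linarith
  set d : ℝ := μ / p with hd
  have hdpos : 0 < d := div_pos hμpos hp0
  have hdp : d * p = μ := by rw [hd]; field_simp
  have hn1 : 1 ≤ n := by
    have h1 : (1 : ℝ) ≤ n := le_trans (by linarith [div_nonneg (sq_nonneg p) hμpos.le]) hn
    exact_mod_cast h1
  have inv : ∀ m : ℕ, m + 1 ≤ n → D (m + 2) ≤ (p - m * d) * D (m + 1) := by
    intro m
    induction m with
    | zero =>
      intro _
      have h := hrec 0 (by omega) (hcon 1 (by omega)).le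
      simp only [Nat.cast_zero, zero_mul, sub_zero]
      nlinarith [hD0, h]
    | succ m ih =>
      intro hm
      have hprev := ih (by omega)
      have hpos1 : 0 < D (m + 1) := hcon (m + 1) (by omega)
      have hpos2 : 0 < D (m + 2) := hcon (m + 2) (by omega)
      set s : ℝ := p - m * d with hs
      have hspos : 0 < s := by
        rcases le_or_gt s 0 with hsn | hsp
        · have : D (m + 2) ≤ 0 := hprev.trans (mul_nonpos_of_nonpos_of_nonneg hsn hpos1.le)
          linarith
        · exact hsp
      have hsle : s ≤ p := by
        rw [hs]; nlinarith [hdpos, (Nat.cast_nonneg m : (0 : ℝ) ≤ m)]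
      have hlow : D (m + 2) / s ≤ D (m + 1) := by rw [div_le_iff₀ hspos]; linarith [hprev, mul_comm s (D (m + 1))]
      have hr := hrec (m + 1) (by omega) hpos2.le
      have h3 : D (m + 1 + 2) ≤ (p - θ / s) * D (m + 2) := by
        have hθs : θ * (D (m + 2) / s) ≤ θ * D (m + 1) := mul_le_mul_of_nonneg_left hlow hθ.le
        have e : (p - θ / s) * D (m + 2) = p * D (m + 2) - θ * (D (m + 2) / s) := by ring
        rw [e]
        have e2 : D (m + 1 + 1) = D (m + 2) := rfl
        rw [e2] at hr
        linarith
      have hquad : μ ≤ s ^ 2 - p * s + θ := by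
        rw [hμ]; nlinarith [sq_nonneg (s - p / 2)]
      have hcoef : p - θ / s ≤ s - d := by
        rw [sub_le_iff_le_add, ← sub_le_iff_le_add', le_div_iff₀ hspos] at *
        · nlinarith [hquad, hsle, hdpos, hdp]
      calc D (m + 1 + 2) ≤ (p - θ / s) * D (m + 2) := h3
        _ ≤ (s - d) * D (m + 2) := mul_le_mul_of_nonneg_right hcoef hpos2.le
        _ = (p - ((m + 1 : ℕ) : ℝ) * d) * D (m + 1 + 1) := by rw [hs]; push_cast; ring
  obtain ⟨m, rfl⟩ : ∃ m, n = m + 1 := ⟨n - 1, by omega⟩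
  have hlast := inv m le_rfl
  have hfac : p - (m : ℝ) * d ≤ 0 := by
    have hm : p ^ 2 / μ ≤ (m : ℝ) := by
      have : ((m + 1 : ℕ) : ℝ) = (m : ℝ) + 1 := by push_cast; ring
      rw [this] at hn; linarith
    have : p ^ 2 ≤ (m : ℝ) * μ := by rwa [div_le_iff₀ hμpos] at hm
    nlinarith [hdp, this, hp0]
  have hDm1 : 0 < D (m + 1) := hcon (m + 1) (by omega)
  have hDm2 : 0 < D (m + 2) := hcon (m + 2) (by omega)
  have : D (m + 2) ≤ 0 := hlast.trans (mul_nonpos_of_nonpos_of_nonneg hfac hDm1.le)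
  linarith

/-- **FINITE HORIZON, p ≤ 0**: the first two-term inequality alone (k = 0) forces D_1 ≤ 0 or D_2 < 0 when D_0 > 0. [folklore] -/
theorem oscillation_nonpos_fin {θ p : ℝ} {D : ℕ → ℝ} (hθ : 0 < θ) (hp : p ≤ 0)
    (hrec : 0 ≤ D 1 → D 2 ≤ p * D 1 - θ * D 0) (hD0 : 0 < D 0) :
    ∃ j, j ≤ 2 ∧ D j ≤ 0 := by
  rcases le_or_gt (D 1) 0 with h1 | h1
  · exact ⟨1, by norm_num, h1⟩
  · refine ⟨2, le_rfl, ?_⟩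
    have h := hrec h1.le
    nlinarith [mul_nonpos_of_nonpos_of_nonneg hp h1.le, mul_pos hθ hD0]

/-- **BOTH CASES ON A FINITE HORIZON.**  θ > 0, p < 2√θ (no sign assumed), the two-term inequality for k + 1 ≤ n along nonnegative stretches, D_0 > 0 and
n ≥ max(1, p²∕(θ − p²∕4) + 1) when p > 0 (n ≥ 1 when p ≤ 0) ⟹ some D_j ≤ 0 with j ≤ n + 1.  The form the companion witness consumes. [folklore] -/
theorem oscillation_fin {θ p : ℝ} {D : ℕ → ℝ} (hθ : 0 < θ) (hp : p < 2 * Real.sqrt θ) {n : ℕ} (hn1 : 1 ≤ n)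
    (hn : 0 < p → p ^ 2 / (θ - p ^ 2 / 4) + 1 ≤ n)
    (hrec : ∀ k, k + 1 ≤ n → 0 ≤ D (k + 1) → D (k + 2) ≤ p * D (k + 1) - θ * D k)
    (hD0 : 0 < D 0) : ∃ j, j ≤ n + 1 ∧ D j ≤ 0 := by
  rcases le_or_gt p 0 with hp0 | hp0
  · obtain ⟨j, hj, hDj⟩ := oscillation_nonpos_fin hθ hp0 (hrec 0 (by omega)) hD0
    exact ⟨j, by omega, hDj⟩
  · have hs0 : 0 < Real.sqrt θ := Real.sqrt_pos.mpr hθ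
    have hsq : Real.sqrt θ ^ 2 = θ := Real.sq_sqrt hθ.le
    have hp4 : p ^ 2 < 4 * θ := by nlinarith [hp, hp0, hs0, hsq]
    exact oscillation_pos_fin hθ hp0 hp4 hrec hD0 (hn hp0)

end

end Summit.QuantumFields.BalabanUV.Beta.EriceFlowEnclosureB12AsPrintedPointwiseFadingOrderSharpOscillation
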